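import Summits.Ventures.CertifiedArithmetic.Expansions.Orient2dStageBBounds
import Mathlib.Tactic.Linarith
import Mathlib.Tactic.Positivity
import Mathlib.Tactic.Ring
import Mathlib.Tactic.NormNum

/-!
# ORIENT3D, stage B, part 1b: which constants the stage-B analysis certifies

NEW WORK in the sense of this development (companion of `Orient3dStageBBounds.lean`, whose abstract
theorem `orient3d_stageB_sign_of_bounds` needs THE MARGIN
`(1 + δ)(3ε + 6ε² + 4ε³ + ε⁴) < (1 − ε)⁵·K` for the errbound coefficient `K` and ESTIMATE's
relative error `δ`; with `K = (3 + Cε)ε`, `δ = kε` the margin is `ε²(C − 21 − 3k) + O(ε³)`).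

THE FINDING (about constants, not about the C code).  (a) With the estimate error PROVED in this
development for every weakly nonoverlapping expansion, `δ = 3u` (`EstimateRelativeError.lean`), the
margin needs `C > 30`: `o3derrboundB32_margin` certifies `K = (3 + 32ε)ε` for `0 < ε ≤ 1/128`
(`p ≥ 7`; exact polynomial `ε²(2 − 152ε + 277ε² − 308ε³ + 157ε⁴ − 32ε⁵)`; `C = 31` would need
`p ≥ 8`, `C = 33` gives `p ≥ 6`, `C = 30` never closes).  (b) Shewchuk's published
`o3derrboundB = (3 + 28ε)ε` (Table 3 p. 351, line B; `predicates.c`) closes this margin only for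
`k ≤ 7/3`; his justification (p. 349, stated for ORIENT2D's line B: "B′ approximates B with
relative error less than 2ε", resting on p. 333 "the result errs by less than one ulp") is `k = 2`,
for which `o3derrboundB_margin_of_two` indeed certifies `(3 + 28ε)ε` (`0 < ε ≤ 1/128`, polynomial
`ε²(1 − 126ε + 241ε² − 267ε³ + 137ε⁴ − 28ε⁵)`).  But `k = 2` is not available to us: the exhaustive
exact-model searches recorded with `EstimateRelativeError.lean` exhibit 4-component nonoverlapping
expansions on which round-to-nearest-EVEN estimation overshoots by `2.13ε|B|` (`p = 5`) and by
`2.30ε|B|` (`p = 6`: `⟨−5, −112, −256, 512⟩`, `estimate = 144`, `B = 139`); what the worst case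
is at `p = 53` we do not know (proved: `≤ 3ε`).  CONSEQUENTLY the stage-B soundness theorem of this
development (part 2, once `EstimateRelativeError.lean` is in the tree) will carry the constant
`o3derrboundB32 = (3 + 32ε)ε`, `p ≥ 7`.  NOTHING is claimed about `predicates.c` returning a wrong
sign: that would need near-extremal rounding in the permanent, in the tails AND in the estimate at
once; we have neither an example nor a proof of impossibility — it is OPEN.

Contents: the two margins; `unitRoundoff_le_of_seven_le`; the constants `o3derrboundB` (Shewchuk's,
for the record) and `o3derrboundB32`, their grid `2^(−2p)ℤ`, and `isFloat_o3derrboundB32`.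
References: J. R. Shewchuk, Discrete Comput. Geom. 18 (1997) 305–363, §4.4 Table 3 p. 351, §4.3
p. 349, §2.7 p. 333; `predicates.c` (`exactinit`, `orient3dadapt`) [Shewchuk1997].
-/

namespace Summit.Ventures.CertifiedArithmetic.Expansions

open Literature.ComputerArithmetic.JeannerodRump2018
open Literature.ComputerArithmetic.BoldoJeannerodMelquiondMuller2023 hiding twoSum twoSum_fst
  isFloat_twoSum
open Literature.ComputerArithmetic.Shewchuk1997

variable {p : ℕ} {emin : ℤ}

/-! ## The margins -/

/-- **The margin with the PROVED estimate error `δ = 3ε` and the constant `(3 + 32ε)ε`**: for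
`0 < ε ≤ 1/128` (`p ≥ 7`), `(1 + 3ε)(3ε + 6ε² + 4ε³ + ε⁴) < (1 − ε)⁵(3 + 32ε)ε`, the difference
being `ε²(2 − 152ε + 277ε² − 308ε³ + 157ε⁴ − 32ε⁵)` with `2 − 152ε ≥ 2 − 152/128 > 0`,
`277ε² ≥ 308ε³`, `157ε⁴ ≥ 32ε⁵`.  (`C = 31` needs `p ≥ 8`; `C = 30` never closes.) -/
theorem o3derrboundB32_margin {u : ℚ} (hu0 : 0 < u) (hu : u ≤ 1 / 128) :
    (1 + 3 * u) * (3 * u + 6 * u ^ 2 + 4 * u ^ 3 + u ^ 4) < (1 - u) ^ 5 * ((3 + 32 * u) * u) := by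
  have hkey : (1 - u) ^ 5 * ((3 + 32 * u) * u) - (1 + 3 * u) * (3 * u + 6 * u ^ 2 + 4 * u ^ 3
      + u ^ 4) = u ^ 2 * (2 - 152 * u + 277 * u ^ 2 - 308 * u ^ 3 + 157 * u ^ 4 - 32 * u ^ 5) := by
    ring
  have h1 : 0 < 2 - 152 * u := by linarith
  have h2 : 0 ≤ 277 * u ^ 2 - 308 * u ^ 3 := by
    have h : 0 ≤ 277 - 308 * u := by linarith
    have := mul_nonneg (pow_nonneg hu0.le 2) h
    linarith
  have h3 : 0 ≤ 157 * u ^ 4 - 32 * u ^ 5 := by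
    have h : 0 ≤ 157 - 32 * u := by linarith
    have := mul_nonneg (pow_nonneg hu0.le 4) h
    linarith
  have hpoly : 0 < 2 - 152 * u + 277 * u ^ 2 - 308 * u ^ 3 + 157 * u ^ 4 - 32 * u ^ 5 := by
    linarith
  have := mul_pos (pow_pos hu0 2) hpoly
  rw [← hkey] at this
  linarith

/-- **Shewchuk's constant under Shewchuk's estimate bound**: IF the estimate error were `δ = 2ε`
(p. 349: "relative error less than 2ε"), then `(3 + 28ε)ε` would close the margin for
`0 < ε ≤ 1/128`: the difference is `ε²(1 − 126ε + 241ε² − 267ε³ + 137ε⁴ − 28ε⁵)`.  Recorded to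
pin down exactly what Table 3, line B rests on; `δ = 2ε` is contradicted at `p = 5, 6` by the
exhaustive searches of `EstimateRelativeError.lean` and is not available at `p = 53` either way. -/
theorem o3derrboundB_margin_of_two {u : ℚ} (hu0 : 0 < u) (hu : u ≤ 1 / 128) :
    (1 + 2 * u) * (3 * u + 6 * u ^ 2 + 4 * u ^ 3 + u ^ 4) < (1 - u) ^ 5 * ((3 + 28 * u) * u) := by
  have hkey : (1 - u) ^ 5 * ((3 + 28 * u) * u) - (1 + 2 * u) * (3 * u + 6 * u ^ 2 + 4 * u ^ 3
      + u ^ 4) = u ^ 2 * (1 - 126 * u + 241 * u ^ 2 - 267 * u ^ 3 + 137 * u ^ 4 - 28 * u ^ 5) := by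
    ring
  have h1 : 0 < 1 - 126 * u := by linarith
  have h2 : 0 ≤ 241 * u ^ 2 - 267 * u ^ 3 := by
    have h : 0 ≤ 241 - 267 * u := by linarith
    have := mul_nonneg (pow_nonneg hu0.le 2) h
    linarith
  have h3 : 0 ≤ 137 * u ^ 4 - 28 * u ^ 5 := by
    have h : 0 ≤ 137 - 28 * u := by linarith
    have := mul_nonneg (pow_nonneg hu0.le 4) h
    linarith
  have hpoly : 0 < 1 - 126 * u + 241 * u ^ 2 - 267 * u ^ 3 + 137 * u ^ 4 - 28 * u ^ 5 := by
    linarith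
  have := mul_pos (pow_pos hu0 2) hpoly
  rw [← hkey] at this
  linarith

/-- `u = 2^−p ≤ 1/128` for `p ≥ 7`. -/
theorem unitRoundoff_le_of_seven_le (hp : 7 ≤ p) : unitRoundoff p ≤ 1 / 128 := by
  unfold unitRoundoff
  have h : (128 : ℚ) ≤ 2 ^ p := by
    calc (128 : ℚ) = 2 ^ 7 := by norm_num
      _ ≤ 2 ^ p := pow_le_pow_right₀ (by norm_num) hp
  exact one_div_le_one_div_of_le (by norm_num) h

/-! ## The constants -/

/-- Shewchuk's coefficient of Table 3, line B (`predicates.c` `exactinit`: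
`o3derrboundB = (3.0 + 28.0 * epsilon) * epsilon`).  Recorded for reference; NOT certified by the
analysis of this file with the estimate error available to us (see the module docstring). -/
def o3derrboundB (p : ℕ) : ℚ := (3 + 28 * unitRoundoff p) * unitRoundoff p

/-- The coefficient this development certifies for the stage-B test with `δ = 3u`, `p ≥ 7`:
`(3 + 32ε)ε` (representable for `p ≥ 7`: `(3·2^(p−5) + 1)·2^(5−2p)`, `p − 3` significant bits,
`isFloat_o3derrboundB32`). -/
def o3derrboundB32 (p : ℕ) : ℚ := (3 + 32 * unitRoundoff p) * unitRoundoff p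

/-- `o3derrboundB = (3·2^p + 28)·2^(−2p)` lies on the grid `2^(−2p) ℤ`. -/
theorem onGrid_o3derrboundB (p : ℕ) : OnGrid (-(2 * (p : ℤ))) (o3derrboundB p) := by
  refine ⟨3 * 2 ^ p + 28, ?_⟩
  unfold o3derrboundB unitRoundoff
  have h2 : (2 : ℚ) ^ p ≠ 0 := pow_ne_zero _ (by norm_num)
  rw [show (-(2 * (p : ℤ))) = -((p : ℤ) + (p : ℤ)) by ring, zpow_neg, zpow_add₀ (by norm_num),
    zpow_natCast]
  push_cast
  field_simp

/-- `o3derrboundB32 = (3·2^p + 32)·2^(−2p)` lies on the grid `2^(−2p) ℤ`. -/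
theorem onGrid_o3derrboundB32 (p : ℕ) : OnGrid (-(2 * (p : ℤ))) (o3derrboundB32 p) := by
  refine ⟨3 * 2 ^ p + 32, ?_⟩
  unfold o3derrboundB32 unitRoundoff
  have h2 : (2 : ℚ) ^ p ≠ 0 := pow_ne_zero _ (by norm_num)
  rw [show (-(2 * (p : ℤ))) = -((p : ℤ) + (p : ℤ)) by ring, zpow_neg, zpow_add₀ (by norm_num),
    zpow_natCast]
  push_cast
  field_simp

/-- `o3derrboundB32 = (3·2^(p−5) + 1)·2^(5−2p)` is a float of `F(p, emin)` for `p ≥ 7` and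
`emin ≤ 5 − 2p` (it has `p − 3` significant bits). -/
theorem isFloat_o3derrboundB32 (hp : 7 ≤ p) (hemin : emin ≤ 5 - 2 * (p : ℤ)) :
    IsFloat p emin (o3derrboundB32 p) := by
  refine ⟨3 * 2 ^ (p - 5) + 1, 5 - 2 * (p : ℤ), ?_, hemin, ?_⟩
  · have h5 : p - 5 + 3 ≤ p := by omega
    have habs : |(3 : ℤ) * 2 ^ (p - 5) + 1| = 3 * 2 ^ (p - 5) + 1 := abs_of_nonneg (by positivity)
    rw [habs]
    calc (3 : ℤ) * 2 ^ (p - 5) + 1 < 4 * 2 ^ (p - 5) + 4 * 2 ^ (p - 5) := by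
          have : (1 : ℤ) ≤ 2 ^ (p - 5) := one_le_pow₀ (by norm_num)
          linarith
      _ = 2 ^ (p - 5 + 3) := by ring
      _ ≤ 2 ^ p := pow_le_pow_right₀ (by norm_num) h5
  · unfold o3derrboundB32 unitRoundoff
    have hp5 : (p : ℤ) = ((p - 5 : ℕ) : ℤ) + 5 := by omega
    have h2 : (2 : ℚ) ≠ 0 := by norm_num
    rw [show (5 - 2 * (p : ℤ)) = -(((p - 5 : ℕ) : ℤ)) + (-(((p - 5 : ℕ) : ℤ)) - 5) by omega,
      zpow_add₀ h2, zpow_sub₀ h2, zpow_neg, zpow_natCast,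
      show (2 : ℚ) ^ p = 2 ^ (p - 5) * 2 ^ 5 by rw [← pow_add]; congr 1; omega]
    push_cast
    field_simp
    ring

end Summit.Ventures.CertifiedArithmetic.Expansions
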